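import Literature.NumberTheory.GaloisRepresentations.TateDualLimitSelmerTorsionFree
import Literature.NumberTheory.GaloisRepresentations.TateDualLimitPairingSumFormula
import Literature.NumberTheory.GaloisRepresentations.PontryaginTateDualInverseLimitScalars
import Literature.NumberTheory.GaloisCohomology.PoitouTateSelmerStructures
import HarnessLib

/-!
# `S_{𝓛*}(K, T*)` read levelwise: limit classes from threads, and the `Λ`-adic dual local condition
# as the levelwise dual local conditions (Greenberg 2010 §2, §3.1; theorems only)

Topic `NumberTheory/GaloisRepresentations`; namespace
`Literature.NumberTheory.GaloisRepresentations.DiscreteGaloisModule.TorsionLayers`.  THEOREMS ONLY (no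
definition, no named fact, no `sorry`, no instance).  Lane «SUR-Λ» of cell `bsd-eis` (road memo
`SUR-LAMBDA-ROAD-w5g9.md` §2 ★(ε), brick C6 final part 1), `--supports stmt-BirchSwinnertonDyer-19032`.

MATHEMATICS (R. Greenberg, *Surjectivity of the global-to-local map defining a Selmer group*, Kyoto
J. Math. 50 (2010), §2 p. 6 and §3.1 p. 14): `T* = lim_k Hom(D_k, μ_{p^k})` for a torsion tower
`(D_k)_k` of the discrete `Γ_K`-module `D` (the tree's `TorsionLayers`, `dualSystem`,
`H¹_cont(Γ_K, T*) ≃ lim_k H¹(Γ_K, Hom(D_k, μ_{p^k}))` = `continuousCohomologyOneEquiv`, NSW (2.7.5)),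
with the `Λ`-adic local pairing `⟪·,·⟫_v` on `H¹(K_v, D) × H¹_cont(K_v, T*)` assembled from the level
pairings (`TateDualLimitLocalPairing.lean`: `limitPairing`, `levelPairing`, `dualLocalCondition L = L^⊥`;
localisation `locDual` of `TateDualLimitSelmerTorsionFree.lean`).  Greenberg's Selmer group
`S_{𝓛*}(K, T*)` is cut out by `loc_v y ∈ L_v^⊥` (`v ∈ Σ`); the finite-level Poitou–Tate arguments of
Prop. 3.2.1 see instead the components `y_k = H¹(proj_k) y` and the dual Selmer groups of the level
conditions `((D_k ⊆ D)_*)⁻¹ L_v`.  This file is the dictionary between the two: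

* §1 `cohomologyMap_redHom_refl`, `cohomologyMap_redHom_trans` — functoriality of `H¹` of the
  transitions of `dualSystem` on classes; **`exists_limitClass_of_thread`** — a thread
  `(y_j ∈ H¹(Γ_K, Hom(D_{m₀+j}, μ)))_j`, compatible under the one-step transitions, IS the family of
  components `(H¹(proj_{m₀+j}) Y)_j` of a class `Y ∈ H¹_cont(Γ_K, T*)` (extend along the cofinal chain
  `j ↦ m₀ + j`, `DiscreteInvSystem.exists_extend`, then invert `continuousCohomologyOneEquiv`);
  `cohomologyMap_redHom_projHom` — the components of a limit class are compatible.
* §2 `localProj_locDual` — `(loc_v Y)_k = loc_v (Y_k)` (the tree's `localProj_map_restrict` in the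
  `locDual` spelling); **`locDual_mem_dualLocalCondition_iff`** — under the level-change law for the
  family `inv` at `v`: `loc_v Y ∈ L_v^⊥ ↔ ∀ k, loc_v (Y_k) ∈ (((D_k ⊆ D)_*)⁻¹ L_v)^{*,inv_k}` (the
  levelwise dual local conditions `LocalInvariants.dualLocalCondition`): `⟪(D_k ⊆ D)_* t', loc_v Y⟫ =
  ι_{p^k} ⟨t', (loc_v Y)_k⟩` (`limitPairingFun_localSubtypeMap`), `ι_{p^k}` injective, and every local
  class of `D` comes from a level (`exists_localSubtypeMap_eq`).

HONESTY: bookkeeping between two currencies of the tree; nothing of Greenberg's propositions or of BSD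
is proved here.  AI formalisation, weaker than expert review; the statements are established only by
the kernel check.

## References
* R. Greenberg, *Surjectivity of the global-to-local map defining a Selmer group*, Kyoto J. Math.
  50 (2010) 853–888, §2 p. 6 (the pairing (5), `L(K_v, T*)`), §3.1 p. 14, Prop. 3.2.1 p. 15.
  [Greenberg2010]
* J. Neukirch, A. Schmidt, K. Wingberg, *Cohomology of Number Fields*, 2nd ed. (2008), (2.7.5).
  [NeukirchSchmidtWingberg2008]
-/

noncomputable section

open Function CategoryTheory NumberField IsDedekindDomain Field
open _root_.TopRep _root_.ContRepresentation _root_.ContinuousCohomology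
open scoped ContRepresentation
open Literature.NumberTheory.GaloisRepresentations.DiscreteGaloisModule
open Literature.NumberTheory.GaloisCohomology (LocalInvariants)
open Literature.AnabelianGeometry.AbsoluteAnabelian.Prop121vii (zmodToQmodZ zmodToQmodZ_injective)

namespace Literature.NumberTheory.GaloisRepresentations

namespace DiscreteGaloisModule.TorsionLayers

variable {K : Type} [Field K] {D : Type} [AddCommGroup D] [TopologicalSpace D] [DiscreteTopology D]
  {τ : DiscreteGaloisModule K D} {p : ℕ} (E : τ.TorsionLayers p)

/-! ### §1. Threads of the dual tower as limit classes -/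

/-- `H¹` of the identity transition is the identity on classes. [cite: NeukirchSchmidtWingberg2008, II §7 Thm 2.7.5] -/
theorem cohomologyMap_redHom_refl (n : ℕ) (x : continuousCohomology 1 (E.dualSystem.ρ n).toTopRep) :
    cohomologyMap (E.dualSystem.redHom (le_refl n)) 1 x = x := by
  obtain ⟨f, rfl⟩ := oneCocycleClass_surjective _ x
  rw [E.dualSystem.cohomologyMap_redHom_oneCocycleClass]
  exact congrArg _ (E.dualSystem.redCocycle₁_refl n f)

/-- `H¹` of a composite transition is the composite on classes. [cite: NeukirchSchmidtWingberg2008, II §7 Thm 2.7.5] -/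
theorem cohomologyMap_redHom_trans {a b c : ℕ} (h₁ : a ≤ b) (h₂ : b ≤ c)
    (x : continuousCohomology 1 (E.dualSystem.ρ c).toTopRep) :
    cohomologyMap (E.dualSystem.redHom (h₁.trans h₂)) 1 x =
      cohomologyMap (E.dualSystem.redHom h₁) 1 (cohomologyMap (E.dualSystem.redHom h₂) 1 x) := by
  obtain ⟨f, rfl⟩ := oneCocycleClass_surjective _ x
  rw [E.dualSystem.cohomologyMap_redHom_oneCocycleClass, E.dualSystem.cohomologyMap_redHom_oneCocycleClass,
    E.dualSystem.cohomologyMap_redHom_oneCocycleClass]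
  exact congrArg _ (E.dualSystem.redCocycle₁_trans h₁ h₂ f)

/-- The components `Y_k = H¹(proj_k) Y` of a class `Y ∈ H¹_cont(Γ_K, T*)` are compatible under the
transitions. [cite: NeukirchSchmidtWingberg2008, II §7 Thm 2.7.5] -/
theorem cohomologyMap_redHom_projHom {n m : ℕ} (h : n ≤ m)
    (Y : continuousCohomology 1 E.dualSystem.limitRep.toTopRep) :
    cohomologyMap (E.dualSystem.redHom h) 1 (cohomologyMap (E.dualSystem.projHom m) 1 Y) =
      cohomologyMap (E.dualSystem.projHom n) 1 Y :=
  (E.dualSystem.toCohomologyLimit₁ Y).2 h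

/-- **A one-step-compatible thread from level `m₀` on is the family of components of a limit class**:
for `y_j ∈ H¹(Γ_K, Hom(D_{m₀+j}, μ_{p^{m₀+j}}))` with `(y_{j+1})|_{D_{m₀+j}} = y_j` there is
`Y ∈ H¹_cont(Γ_K, T*)` with `H¹(proj_{m₀+j}) Y = y_j` for all `j` (NSW (2.7.5): extend along the cofinal
chain `j ↦ m₀ + j` and invert `H¹_cont(Γ_K, T*) ≃ lim_k H¹(Γ_K, Hom(D_k, μ_{p^k}))`).
[cite: NeukirchSchmidtWingberg2008, II §7 Thm 2.7.5] [cite: Greenberg2010, §2 p. 6 L1–12] -/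
theorem exists_limitClass_of_thread [NeZero p] (m₀ : ℕ)
    (y : ∀ j : ℕ, continuousCohomology 1 (E.dualSystem.ρ (m₀ + j)).toTopRep)
    (hy : ∀ j, cohomologyMap (E.dualSystem.redHom (Nat.le_succ (m₀ + j))) 1 (y (j + 1)) = y j) :
    ∃ Y : continuousCohomology 1 E.dualSystem.limitRep.toTopRep,
      ∀ j, cohomologyMap (E.dualSystem.projHom (m₀ + j)) 1 Y = y j := by
  let c : E.dualSystem.CofinalChain :=
    { seq := fun j => m₀ + j
      le_succ := fun j => Nat.le_succ (m₀ + j)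
      cofinal := fun n => ⟨n, Nat.le_add_left n m₀⟩ }
  obtain ⟨z, hz, hzy⟩ := E.dualSystem.exists_extend c
    (β := fun n => continuousCohomology 1 (E.dualSystem.ρ n).toTopRep)
    (fun h x => cohomologyMap (E.dualSystem.redHom h) 1 x)
    (fun n x => E.cohomologyMap_redHom_refl n x)
    (fun h₁ h₂ x => E.cohomologyMap_redHom_trans h₁ h₂ x) y hy
  refine ⟨E.continuousCohomologyOneEquiv.symm ⟨z, fun n m h => hz h⟩, fun j => ?_⟩
  rw [← coe_continuousCohomologyOneEquiv_apply, AddEquiv.apply_symm_apply]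
  exact hzy j

/-! ### §2. The `Λ`-adic dual local condition, levelwise -/

variable [NumberField K] [∀ k, Finite (E.N k)] [NeZero p] (inv : ∀ k : ℕ, LocalInvariants K (p ^ k))
  (v : Place K)

omit [NeZero p] in
/-- **`(loc_v Y)_k = loc_v (Y_k)`** — the tree's `localProj_map_restrict`, with the localisation of
`H¹_cont(Γ_K, T*)` written as `locDual`. [cite: SerreGaloisCohomology1997, I §2.4]
[cite: NeukirchSchmidtWingberg2008, II §7 Thm 2.7.5] -/
theorem localProj_locDual [CompactSpace (absoluteGaloisGroup K)] (k : ℕ)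
    (Y : continuousCohomology 1 E.dualSystem.limitRep.toTopRep) :
    E.localProj v k (E.locDual (absGaloisRestrict K (Place.Completion v)) Y) =
      galoisCohomology.localization ((E.layerRep k).tateDual (p ^ k)) v 1
        (cohomologyMap (E.dualSystem.projHom k) 1 Y) :=
  E.localProj_map_restrict v k Y

variable {E inv v} in
/-- **`loc_v Y ∈ L_v^⊥ ↔ ∀ k, loc_v (Y_k) ∈ (((D_k ⊆ D)_*)⁻¹ L_v)^*`** — the `Λ`-adic dual local condition
of Greenberg's `S_{𝓛*}(K, T*)` is the conjunction of the LEVELWISE dual local conditions (for the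
family `inv`, under its level-change law at `v`). [cite: Greenberg2010, §2 p. 6 (5), §3.1 p. 14 (9)] -/
theorem locDual_mem_dualLocalCondition_iff [CompactSpace (absoluteGaloisGroup K)] (hinv : InvLevelLaw inv v)
    (L : AddSubgroup (galoisCohomology (τ.toLocal v) 1))
    (Y : continuousCohomology 1 E.dualSystem.limitRep.toTopRep) :
    E.locDual (absGaloisRestrict K (Place.Completion v)) Y ∈ E.dualLocalCondition inv v L ↔
      ∀ k : ℕ, galoisCohomology.localization ((E.layerRep k).tateDual (p ^ k)) v 1
          (cohomologyMap (E.dualSystem.projHom k) 1 Y) ∈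
        (inv k).dualLocalCondition (E.layerRep k) v (L.comap (E.localSubtypeMap v k)) := by
  constructor
  · intro hY k
    refine (LocalInvariants.mem_dualLocalCondition_iff _ _ _ _ _).2 fun a ha => ?_
    apply zmodToQmodZ_injective (p ^ k)
    have h := (mem_dualLocalCondition_iff L _).1 hY (E.localSubtypeMap v k a) ha
    rw [limitPairingFun_localSubtypeMap hinv, levelPairing_apply, localProj_locDual] at h
    rw [h, map_zero]
  · intro hY
    refine (mem_dualLocalCondition_iff L _).2 fun t ht => ?_
    obtain ⟨k, t', rfl⟩ := E.exists_localSubtypeMap_eq v t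
    rw [limitPairingFun_localSubtypeMap hinv, levelPairing_apply, localProj_locDual,
      (LocalInvariants.mem_dualLocalCondition_iff _ _ _ _ _).1 (hY k) t' ht, map_zero]

end DiscreteGaloisModule.TorsionLayers

end Literature.NumberTheory.GaloisRepresentations
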